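import Mathlib

/-!
# The divisibility locus — kernel skeleton (hsemireg-alphabet-isogeny-1 g11)

EVIDENCE for the LINE `stmt-HodgeConjecture-18881 Cruxes/BlochSeedDiscOne/Lines/birth.lean 814a6a70c14e831a
stub_rung_pad4_seedAt`, not a rung.  Nothing here is proved toward HC ∕ HC_CM ∕ HC_AV ∕ №4 ∕ 26512 ∕ 18881 ∕ H2.
Mathlib-only; no `sorry`, no `instance`, no `notation`, no `allowUnsafeReducibility`.

Memo of record: `run/shared/lean/pub/pub-hsemireg/hsemireg-alphabet-isogeny-1/SPEC-ISOGENY-ALPHABET-isogeny1-g11.md`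
(v1.10: LEMMA 2.1 «letter root ⇒ divisibility», THEOREM A′ «μ-killing certificates need no positivity», THEOREM B
«a purely mixing class divides nothing with q ≠ 0», (S4) «|μ| ≤ 192 q for effective classes»).

WHAT IS KERNEL-CHECKED HERE is only the generic ring ∕ field SKELETON of those four statements, with the exterior
algebra 𝒜 = ⊕ H^{k,k}(E⁸) replaced by an arbitrary commutative `K`-algebra `R` and the machine-checked identities of the
memo (`h⁴ ∧ P_U = 384·top`, `δ_U ∧ P_U = 0`, the Cauchy–Binet evaluation of a certificate, `h⁴·Π n_a = 384`,
`w_AB·Π n_a = phase`) entering as HYPOTHESES.  The dictionary (𝒜, the forms, the exact engines `code/g11/*.py`) is NOT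
formalised; see the memo §7 for what is engine-checked and how to reproduce it.
* §1 `root_divides_c₄` — LEMMA 2.1(iii): a root `δ` of the Chern polynomial makes `c₄` a multiple of `δ`.
* §2 `q_eq_zero_of_annihilator` — THEOREM B's mechanism: an element `P` with `δ P = w_AB P = w_BA P = 0` and
  `h⁴ P = 384·top`, `top` torsion-free, forces `q = 0` in `q h⁴ + μ w_AB + μ' w_BA = δ γ`.
* §3 `mu_eq_zero_of_certificate` — THEOREM A′'s mechanism: a `K`-linear functional killing `δ·R`, vanishing on `h⁴`
  and `w_BA` and not on `w_AB`, forces `μ = 0`.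
* §4 `weilCharge_le` — (S4): `0 ≤ 384 q + 2 Re(μ ζ)` for all unit `ζ` gives `‖μ‖ ≤ 192 q`.
-/

namespace HsemiregIsogeny1.Indivisibility

section Ring

variable {K R : Type*} [Field K] [CommRing R] [Algebra K R]

/-! ## §1 Letter root ⇒ divisibility (LEMMA 2.1 (iii)) -/

/-- If `δ` is a root of `F(T) = T⁴ − c₁T³ + c₂T² − c₃T + c₄` over a commutative ring, then `c₄ = δ·γ` with the
explicit cofactor `γ = −δ³ + c₁δ² − c₂δ + c₃` (remainder theorem). -/
theorem root_divides_c₄ (δ c₁ c₂ c₃ c₄ : R)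
    (hroot : δ ^ 4 - c₁ * δ ^ 3 + c₂ * δ ^ 2 - c₃ * δ + c₄ = 0) :
    c₄ = δ * (-δ ^ 3 + c₁ * δ ^ 2 - c₂ * δ + c₃) := by
  linear_combination hroot

/-- LEMMA 2.1 (i), rank-one case, as bookkeeping: for `c(𝓔) = (1 + δ)·(1 + q₁ + q₂ + q₃)` (a line sub-bundle of
slope `δ` with locally free rank-3 quotient, so `c₄(𝓠) = 0`) the degree-4 part is `δ·q₃`; stated as the identity
between the full products with the vanishing `q₄` displayed. -/
theorem c₄_of_line_subbundle (δ q₃ q₄ c₄ : R) (hq₄ : q₄ = 0) (hc₄ : c₄ = δ * q₃ + q₄) :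
    ∃ γ : R, c₄ = δ * γ :=
  ⟨q₃, by rw [hc₄, hq₄, add_zero]⟩

/-! ## §2 THEOREM B — the annihilator mechanism -/

/-- THEOREM B (skeleton).  In the memo: `δ = δ_U` purely mixing, `P = P_U = Π_a h′_a` in the singular frame of `U`,
`top = h⁸/40320`; the four product hypotheses are the machine-checked identities of `theoremB_check.log`. -/
theorem q_eq_zero_of_annihilator
    (δ P wAB wBA h4 top γ : R) (q μ μ' : K)
    (hδP : δ * P = 0) (hAB : wAB * P = 0) (hBA : wBA * P = 0)
    (hh4 : h4 * P = (384 : K) • top)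
    (htop : ∀ c : K, c • top = 0 → c = 0)
    (h384 : (384 : K) ≠ 0)
    (hT : q • h4 + μ • wAB + μ' • wBA = δ * γ) :
    q = 0 := by
  have hmul : (q • h4 + μ • wAB + μ' • wBA) * P = δ * γ * P := by rw [hT]
  have lhs : (q • h4 + μ • wAB + μ' • wBA) * P = (q * 384) • top := by
    rw [add_mul, add_mul, smul_mul_assoc, smul_mul_assoc, smul_mul_assoc, hAB, hBA, hh4, smul_zero, smul_zero,
      add_zero, add_zero, smul_smul]
  have rhs : δ * γ * P = 0 := by
    rw [mul_assoc, mul_comm γ P, ← mul_assoc, hδP, zero_mul]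
  have key : (q * 384) • top = 0 := by rw [← lhs, hmul, rhs]
  have := htop _ key
  rcases mul_eq_zero.mp this with h | h
  · exact h
  · exact absurd h h384

/-- The converse direction is NOT claimed: PROPOSITION B′ (engine) says `Π(δ_U)` is the pure-Weil line when `U` is
nondegenerate, i.e. `μ ≠ 0` does occur with `q = 0`.  Recorded here only as the shape of that statement: if some
`γ` realises `(0, −ε, 1)` then every scalar multiple is realised. -/
theorem pureWeil_line_closed_under_scaling (δ wAB wBA γ : R) (ε c : K)
    (hγ : (-ε) • wAB + (1 : K) • wBA = δ * γ) :
    (-(c * ε)) • wAB + c • wBA = δ * (c • γ) := by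
  rw [mul_smul_comm, ← hγ, smul_add, smul_smul, smul_smul, mul_neg, mul_one]

/-! ## §3 THEOREM A′ — the certificate mechanism (no positivity anywhere) -/

/-- THEOREM A′ (skeleton).  In the memo: `ev` = pairing with the decomposable (4,4)-vector `X ∧ Ȳ` of a certificate
(`N = XᵀHȲ = 0` gives `hδ`; `det(XᵀȲ) = 0` gives `h4z`; `o ∈ V_A` gives `hBAz`; the two OPEN conditions
`det X_A ≠ 0`, `T̄ ∩ V_A = 0` give `hABnz`).  Conclusion: `μ = 0` for EVERY `γ`. -/
theorem mu_eq_zero_of_certificate (ev : R →ₗ[K] K) (δ wAB wBA h4 γ : R) (q μ μ' : K)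
    (hδ : ∀ x : R, ev (δ * x) = 0) (h4z : ev h4 = 0) (hBAz : ev wBA = 0) (hABnz : ev wAB ≠ 0)
    (hT : q • h4 + μ • wAB + μ' • wBA = δ * γ) :
    μ = 0 := by
  have happ : ev (q • h4 + μ • wAB + μ' • wBA) = 0 := by rw [hT]; exact hδ γ
  rw [map_add, map_add, map_smul, map_smul, map_smul, h4z, hBAz, smul_zero, smul_zero, zero_add, add_zero,
    smul_eq_mul] at happ
  rcases mul_eq_zero.mp happ with h | h
  · exact h
  · exact absurd h hABnz

/-- The mirror certificate (roles of `A` and `B` exchanged) kills `μ'`; for a REAL class (`μ' = conj μ`) either one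
suffices.  Skeleton of the «for every γ» remark of ERRATUM E: the hypothesis `hδ` quantifies over all of `R`. -/
theorem mu'_eq_zero_of_mirror_certificate (ev : R →ₗ[K] K) (δ wAB wBA h4 γ : R) (q μ μ' : K)
    (hδ : ∀ x : R, ev (δ * x) = 0) (h4z : ev h4 = 0) (hABz : ev wAB = 0) (hBAnz : ev wBA ≠ 0)
    (hT : q • h4 + μ • wAB + μ' • wBA = δ * γ) :
    μ' = 0 := by
  have hT' : q • h4 + μ' • wBA + μ • wAB = δ * γ := by rw [← hT]; abel
  exact mu_eq_zero_of_certificate ev δ wBA wAB h4 γ q μ' μ hδ h4z hABz hBAnz hT'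

end Ring

/-! ## §4 (S4) — the Weil-charge bound from nef pairings -/

section Bound

/-- (S4) skeleton.  In the memo: `384 q + 2 Re(μ ζ) = [Z]·Π_a n_a(ζ_a) ≥ 0` (Kleiman, `Z` effective, `n_a` nef,
`ζ = Π conj ζ_a` any unit complex number).  Conclusion `‖μ‖ ≤ 192 q`. -/
theorem weilCharge_le (q : ℝ) (μ : ℂ)
    (h : ∀ ζ : ℂ, ‖ζ‖ = 1 → 0 ≤ 384 * q + 2 * (μ * ζ).re) : ‖μ‖ ≤ 192 * q := by
  by_cases hμ : μ = 0
  · subst hμ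
    have h1 := h 1 (by simp)
    simp only [zero_mul, Complex.zero_re, mul_zero, add_zero] at h1
    rw [norm_zero]
    linarith
  · have hpos : 0 < ‖μ‖ := norm_pos_iff.mpr hμ
    have hne : (‖μ‖ : ℂ) ≠ 0 := by exact_mod_cast hpos.ne'
    -- the extremal phase ζ = − conj μ / ‖μ‖
    set ζ : ℂ := -(starRingEnd ℂ μ) / (‖μ‖ : ℂ) with hζ
    have hζ1 : ‖ζ‖ = 1 := by
      rw [hζ, norm_div, norm_neg, Complex.norm_conj, Complex.norm_real, Real.norm_eq_abs,
        abs_of_pos hpos, div_self hpos.ne']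
    have hprod : μ * ζ = -(‖μ‖ : ℂ) := by
      rw [hζ, mul_div_assoc', mul_neg, Complex.mul_conj, Complex.normSq_eq_norm_sq, neg_div]
      congr 1
      push_cast
      rw [sq, mul_div_assoc, div_self hne, mul_one]
    have hre : (μ * ζ).re = -‖μ‖ := by
      rw [hprod, Complex.neg_re, Complex.ofReal_re]
    have h2 := h ζ hζ1
    rw [hre] at h2
    linarith

/-- With phases restricted to `μ₄ = {1, i, −1, −i}` (the rational nef classes `f_a^*[o]`, `f_a = z_a + ζ_a w_a`,
`ζ_a ∈ ℤ[i]ˣ`) one still gets the box `|Re μ|, |Im μ| ≤ 192 q`. -/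
theorem weilCharge_box (q : ℝ) (μ : ℂ)
    (h1 : 0 ≤ 384 * q + 2 * (μ * 1).re) (h2 : 0 ≤ 384 * q + 2 * (μ * (-1)).re)
    (h3 : 0 ≤ 384 * q + 2 * (μ * Complex.I).re) (h4 : 0 ≤ 384 * q + 2 * (μ * (-Complex.I)).re) :
    |μ.re| ≤ 192 * q ∧ |μ.im| ≤ 192 * q := by
  simp only [mul_one, mul_neg, Complex.neg_re, Complex.mul_I_re] at h1 h2 h3 h4
  constructor <;> rw [abs_le] <;> constructor <;> linarith

end Bound

end HsemiregIsogeny1.Indivisibility
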